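import Mathlib
import Literature.Probability.Distributions.StdGaussianDensity
import Literature.Probability.LatticeModels.BesselIDebyeAsymptotics
import HarnessLib

/-!
# Crux `SelfNormalisedSkewness` (stmt-QuantumFields-18944, line `Sketch`): stub — the Parseval–Gaussian sandwich

For a finite Parseval frame `a : P → W` of a finite-dimensional real inner product space `W`
(`∑ p, ⟪a p, v⟫² = ‖v‖²`), the Wilson-type weight `exp (-β ∑ p, (1 - cos ⟪a p, v⟫))` restricted
to the small box `{v | ∀ p, |⟪a p, v⟫| < ε}` is squeezed between the Gaussian `exp (-β‖v‖²/2)`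
and `exp (β |P| ε⁴ / 24)` times it (from `1 - x²/2 ≤ cos x ≤ 1 - x²/2 + x⁴/24`, Mathlib's
`Real.one_sub_sq_div_two_le_cos` and the tree's `cos_le_one_sub_sq_half_add_fourth`), and the
Gaussian box integral rescales (`v = x/√β`, Haar change of variables) to an integral against
Mathlib's standard Gaussian `stdGaussian W` (`Literature...stdGaussian_eq_withDensity`).
-/

noncomputable section

open scoped BigOperators ENNReal InnerProductSpace
open MeasureTheory ProbabilityTheory

namespace Summit.QuantumFields.YangMills.Theorems.SelfNormalisedSkewness.Negative

section Helpers

variable {W : Type*} [NormedAddCommGroup W] [InnerProductSpace ℝ W]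

/-- Lower Gaussian comparison for a Parseval frame: `∑ p, (1 - cos ⟪a p, v⟫) ≤ ‖v‖²/2`.
[folklore] -/
theorem sum_one_sub_cos_le_norm_sq_div_two {P : Type*} [Fintype P] (a : P → W)
    (hframe : ∀ v : W, ∑ p, ⟪a p, v⟫_ℝ ^ 2 = ‖v‖ ^ 2) (v : W) :
    ∑ p, (1 - Real.cos ⟪a p, v⟫_ℝ) ≤ ‖v‖ ^ 2 / 2 := by
  calc ∑ p, (1 - Real.cos ⟪a p, v⟫_ℝ) ≤ ∑ p, ⟪a p, v⟫_ℝ ^ 2 / 2 :=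
        Finset.sum_le_sum fun p _ => by
          linarith [Real.one_sub_sq_div_two_le_cos (x := ⟪a p, v⟫_ℝ)]
    _ = ‖v‖ ^ 2 / 2 := by rw [← Finset.sum_div, hframe]

/-- Upper Gaussian comparison on the box: if `|⟪a p, v⟫| < ε` for all `p` then
`‖v‖²/2 - |P| ε⁴/24 ≤ ∑ p, (1 - cos ⟪a p, v⟫)`. [folklore] -/
theorem norm_sq_div_two_sub_le_sum_one_sub_cos {P : Type*} [Fintype P] (a : P → W)
    (hframe : ∀ v : W, ∑ p, ⟪a p, v⟫_ℝ ^ 2 = ‖v‖ ^ 2) {ε : ℝ} {v : W}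
    (hv : ∀ p, |⟪a p, v⟫_ℝ| < ε) :
    ‖v‖ ^ 2 / 2 - Fintype.card P * ε ^ 4 / 24 ≤ ∑ p, (1 - Real.cos ⟪a p, v⟫_ℝ) := by
  have hp : ∀ p, ⟪a p, v⟫_ℝ ^ 2 / 2 - ε ^ 4 / 24 ≤ 1 - Real.cos ⟪a p, v⟫_ℝ := by
    intro p
    have h1 := Literature.Probability.LatticeModels.cos_le_one_sub_sq_half_add_fourth ⟪a p, v⟫_ℝ
    have h2 : ⟪a p, v⟫_ℝ ^ 4 ≤ ε ^ 4 := by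
      have h := pow_le_pow_left₀ (abs_nonneg _) (hv p).le 4
      rwa [Even.pow_abs ⟨2, rfl⟩] at h
    linarith
  calc ‖v‖ ^ 2 / 2 - Fintype.card P * ε ^ 4 / 24
        = ∑ p, (⟪a p, v⟫_ℝ ^ 2 / 2 - ε ^ 4 / 24) := by
          rw [Finset.sum_sub_distrib, ← Finset.sum_div, hframe, Finset.sum_const, Finset.card_univ,
            nsmul_eq_mul]
          ring
    _ ≤ ∑ p, (1 - Real.cos ⟪a p, v⟫_ℝ) := Finset.sum_le_sum fun p _ => hp p

/-- The Jacobian bookkeeping `(2π/β)^{d/2} (2π)^{-d/2} = |(√β ^ d)⁻¹|`. [folklore] -/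
theorem gaussian_scaling_const {β : ℝ} (hβ : 0 < β) (d : ℕ) :
    (2 * Real.pi / β) ^ ((d : ℝ) / 2) * (2 * Real.pi) ^ (-(d : ℝ) / 2) =
      |((Real.sqrt β) ^ d)⁻¹| := by
  have h2π : (0 : ℝ) ≤ 2 * Real.pi := by positivity
  have hsβ : 0 < Real.sqrt β := Real.sqrt_pos.2 hβ
  rw [abs_of_pos (by positivity), Real.div_rpow h2π hβ.le, neg_div, Real.rpow_neg h2π,
    Real.sqrt_eq_rpow, ← Real.rpow_natCast, ← Real.rpow_mul hβ.le,
    show (1 / 2 : ℝ) * (d : ℝ) = (d : ℝ) / 2 by ring]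
  have hA : 0 < (2 * Real.pi) ^ ((d : ℝ) / 2) := Real.rpow_pos_of_pos (by positivity) _
  have hB : 0 < β ^ ((d : ℝ) / 2) := Real.rpow_pos_of_pos hβ _
  field_simp

section Measure

variable [MeasurableSpace W] [BorelSpace W]

/-- The frame box `{v | ∀ p, |⟪a p, v⟫| < ε}` is a measurable set. [folklore] -/
theorem measurableSet_frameBox {P : Type*} [Fintype P] (a : P → W) (ε : ℝ) :
    MeasurableSet {v : W | ∀ p, |⟪a p, v⟫_ℝ| < ε} := by
  have h : {v : W | ∀ p, |⟪a p, v⟫_ℝ| < ε} = ⋂ p, {v : W | |⟪a p, v⟫_ℝ| < ε} := by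
    ext v; simp
  rw [h]
  exact MeasurableSet.iInter fun p =>
    measurableSet_lt (continuous_abs.comp (continuous_const.inner continuous_id)).measurable
      measurable_const

variable [FiniteDimensional ℝ W]

/-- Haar change of variables, `ℝ≥0∞` form: `∫ f (r • x) dx = |r|^{-dim W} ∫ f`. [folklore] -/
theorem lintegral_comp_smul_volume (f : W → ℝ≥0∞) {r : ℝ} (hr : r ≠ 0) :
    ∫⁻ x, f (r • x) = ENNReal.ofReal |(r ^ Module.finrank ℝ W)⁻¹| * ∫⁻ x, f x := by
  calc ∫⁻ x, f (r • x) = ∫⁻ y, f y ∂(Measure.map (r • ·) volume) :=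
        (lintegral_map_equiv f
          (Homeomorph.smul (isUnit_iff_ne_zero.2 hr).unit).toMeasurableEquiv).symm
    _ = ENNReal.ofReal |(r ^ Module.finrank ℝ W)⁻¹| * ∫⁻ x, f x := by
        rw [Measure.map_addHaar_smul volume hr, lintegral_smul_measure, smul_eq_mul]

/-- Haar change of variables, inverse form: `∫ f = |r|^{-dim W} ∫ f (r⁻¹ • x) dx`. [folklore] -/
theorem lintegral_eq_mul_lintegral_comp_inv_smul (f : W → ℝ≥0∞) {r : ℝ} (hr : r ≠ 0) :
    ∫⁻ x, f x = ENNReal.ofReal |(r ^ Module.finrank ℝ W)⁻¹| * ∫⁻ x, f (r⁻¹ • x) := by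
  have h := lintegral_comp_smul_volume (fun x => f (r⁻¹ • x)) hr
  simpa only [smul_smul, inv_mul_cancel₀ hr, one_smul] using h

end Measure

end Helpers

/-- Wave-3 stub W3-1: the cosine weight of a Parseval frame is sandwiched between Gaussians on the
small box, and the Gaussian box integral rescales to the standard Gaussian. [folklore] -/
theorem stub_parsevalGaussianSandwich {W : Type} [NormedAddCommGroup W] [InnerProductSpace ℝ W]
    [FiniteDimensional ℝ W] [MeasurableSpace W] [BorelSpace W] {P : Type} [Fintype P] (a : P → W)
    (hframe : ∀ v : W, ∑ p, ⟪a p, v⟫_ℝ ^ 2 = ‖v‖ ^ 2) {β ε : ℝ} (hβ : 0 < β) (hε : 0 < ε)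
    (ψ : W → ℝ≥0∞) (hψ : Measurable ψ) :
    (∫⁻ v in {v : W | ∀ p, |⟪a p, v⟫_ℝ| < ε}, ψ v * ENNReal.ofReal (Real.exp (-(β * ‖v‖ ^ 2 / 2))) ≤
      ∫⁻ v in {v : W | ∀ p, |⟪a p, v⟫_ℝ| < ε},
        ψ v * ENNReal.ofReal (Real.exp (-(β * ∑ p, (1 - Real.cos ⟪a p, v⟫_ℝ))))) ∧
    (∫⁻ v in {v : W | ∀ p, |⟪a p, v⟫_ℝ| < ε},
        ψ v * ENNReal.ofReal (Real.exp (-(β * ∑ p, (1 - Real.cos ⟪a p, v⟫_ℝ)))) ≤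
      ENNReal.ofReal (Real.exp (β * Fintype.card P * ε ^ 4 / 24)) *
        ∫⁻ v in {v : W | ∀ p, |⟪a p, v⟫_ℝ| < ε}, ψ v * ENNReal.ofReal (Real.exp (-(β * ‖v‖ ^ 2 / 2)))) ∧
    (∫⁻ v in {v : W | ∀ p, |⟪a p, v⟫_ℝ| < ε}, ψ v * ENNReal.ofReal (Real.exp (-(β * ‖v‖ ^ 2 / 2))) =
      ENNReal.ofReal ((2 * Real.pi / β) ^ ((Module.finrank ℝ W : ℝ) / 2)) *
        ∫⁻ x in {x : W | ∀ p, |⟪a p, x⟫_ℝ| < ε * Real.sqrt β}, ψ ((Real.sqrt β)⁻¹ • x) ∂(stdGaussian W)) := by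
  have _ := hε
  have hB : MeasurableSet {v : W | ∀ p, |⟪a p, v⟫_ℝ| < ε} := measurableSet_frameBox a ε
  refine ⟨?_, ?_, ?_⟩
  · -- (i) lower Gaussian bound, pointwise on all of `W`
    refine lintegral_mono fun v => ?_
    refine mul_le_mul_right (ENNReal.ofReal_le_ofReal (Real.exp_le_exp.2 ?_)) _
    have h := mul_le_mul_of_nonneg_left (sum_one_sub_cos_le_norm_sq_div_two a hframe v) hβ.le
    linarith
  · -- (ii) upper Gaussian bound on the box
    set C := ENNReal.ofReal (Real.exp (β * Fintype.card P * ε ^ 4 / 24)) with hC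
    calc ∫⁻ v in {v : W | ∀ p, |⟪a p, v⟫_ℝ| < ε},
          ψ v * ENNReal.ofReal (Real.exp (-(β * ∑ p, (1 - Real.cos ⟪a p, v⟫_ℝ))))
        ≤ ∫⁻ v in {v : W | ∀ p, |⟪a p, v⟫_ℝ| < ε},
          C * (ψ v * ENNReal.ofReal (Real.exp (-(β * ‖v‖ ^ 2 / 2)))) := by
          refine setLIntegral_mono' hB fun v hv => ?_
          rw [mul_left_comm]
          refine mul_le_mul_right ?_ _
          rw [hC, ← ENNReal.ofReal_mul (Real.exp_pos _).le, ← Real.exp_add]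
          refine ENNReal.ofReal_le_ofReal (Real.exp_le_exp.2 ?_)
          have h := mul_le_mul_of_nonneg_left
            (norm_sq_div_two_sub_le_sum_one_sub_cos a hframe hv) hβ.le
          rw [mul_sub] at h
          linarith
      _ = C * ∫⁻ v in {v : W | ∀ p, |⟪a p, v⟫_ℝ| < ε},
          ψ v * ENNReal.ofReal (Real.exp (-(β * ‖v‖ ^ 2 / 2))) :=
          lintegral_const_mul' C _ ENNReal.ofReal_ne_top
  · -- (iii) rescaling `v = x / √β` to the standard Gaussian
    have hsβ : 0 < Real.sqrt β := Real.sqrt_pos.2 hβ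
    have hB' : MeasurableSet {x : W | ∀ p, |⟪a p, x⟫_ℝ| < ε * Real.sqrt β} :=
      measurableSet_frameBox a (ε * Real.sqrt β)
    have hmeas : Measurable ({x : W | ∀ p, |⟪a p, x⟫_ℝ| < ε * Real.sqrt β}.indicator
        fun x => ψ ((Real.sqrt β)⁻¹ • x)) :=
      (hψ.comp (measurable_const_smul _)).indicator hB'
    rw [← lintegral_indicator hB, lintegral_eq_mul_lintegral_comp_inv_smul _ hsβ.ne',
      ← lintegral_indicator hB',
      Literature.Probability.Distributions.lintegral_stdGaussian_eq_lintegral_mul hmeas,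
      ← lintegral_const_mul' _ _ ENNReal.ofReal_ne_top,
      ← lintegral_const_mul' _ _ ENNReal.ofReal_ne_top]
    refine lintegral_congr fun x => ?_
    have hmem : ((Real.sqrt β)⁻¹ • x ∈ {v : W | ∀ p, |⟪a p, v⟫_ℝ| < ε}) ↔
        (x ∈ {x : W | ∀ p, |⟪a p, x⟫_ℝ| < ε * Real.sqrt β}) := by
      simp only [Set.mem_setOf_eq, real_inner_smul_right, abs_mul, abs_inv, abs_of_pos hsβ]
      refine forall_congr' fun p => ?_
      rw [inv_mul_lt_iff₀ hsβ, mul_comm]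
    by_cases hx : x ∈ {x : W | ∀ p, |⟪a p, x⟫_ℝ| < ε * Real.sqrt β}
    · rw [Set.indicator_of_mem (hmem.2 hx), Set.indicator_of_mem hx]
      have hexp : Real.exp (-(β * ‖(Real.sqrt β)⁻¹ • x‖ ^ 2 / 2)) = Real.exp (-‖x‖ ^ 2 / 2) := by
        congr 1
        rw [norm_smul, norm_inv, Real.norm_eq_abs, abs_of_pos hsβ, mul_pow, inv_pow,
          Real.sq_sqrt hβ.le]
        field_simp
      have h2π : (0 : ℝ) ≤ 2 * Real.pi := by positivity
      rw [hexp, ENNReal.ofReal_mul (Real.rpow_nonneg h2π _), ← gaussian_scaling_const hβ,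
        ENNReal.ofReal_mul (Real.rpow_nonneg (div_nonneg h2π hβ.le) _)]
      ring
    · rw [Set.indicator_of_notMem (fun h => hx (hmem.1 h)), Set.indicator_of_notMem hx,
        mul_zero, mul_zero, mul_zero]

end Summit.QuantumFields.YangMills.Theorems.SelfNormalisedSkewness.Negative

end
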